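import Summits.AtomisticToContinuum.Crystallization.Theorems.FrustratedLawDichotomyStrainedPatchRecutLevel

/-!
# THE SHELL GAP TRANSPORTS; (R6)♯ WITH CHART-SIDE COLUMNS ONLY; the designate chart family `𝓘₀ᴿʷᴳ` and the LEAST-SQUARES CORE (R1)+(R7)
# (27623 strained-patch piece, T-side [CORE-FAR]; decomp-a2c lens-5 «RecutPairs», generation 54, step (R6) closed on the chart side)

(Imports `…RecutLevel`.)  `…RecutLevel` proved `levelNear_of_recutOf` modulo shell gaps on BOTH the chart centre and the recut centre and a cap column.  Here:

* §1 ★ `shellGap_recut` — the shell gap itself transports under the local `(1+A)`-correspondence: `ShellGap g₀ y i → ShellGap g₁ y' i'` whenever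
  `g₁(1+α) ≤ g₀(1−α) − (13/5)α` (the outer shell is the binding side; `‖A‖ ≤ α ≤ 1/20`, `nn ≤ 3/2`);
* §2 ★★ `levelNear_of_recutOf'` — (R6)♯ `LevelNear κN♯ t z₀ c₀ z₁ c₁` for every centre-keeping recut `RecutOf A` (`‖A‖ ≤ κL₀t`, `0 ≤ t ≤ 1/60`, both injective) from
  CHART-SIDE data only: `ShellGap (1/20) z₀ c₀`, `nearestDist z₀ c₀ ≤ 7/5`, `GoodAtScale (1/16) (3/2) z₀ c₀` (recut gap `3/100 ≥ 4κL₀t` by §1 since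
  `(3/100)(1+α) ≤ (1/20)(1−α) − (13/5)α ⇔ α ≤ 0.00746 ≥ 1/150`);
* §3 the DESIGNATE objects for the next record: the chart family `ChartFamilyRWG := 𝓘₀ᴿʷ ∧ ShellGap (1/20) ∧ nn ≤ 7/5` (`𝓘₀ᴿʷᴳ`; two geometric clauses,
  instrumentable: census SHELLGAP27), the LEAST-SQUARES CORE `RecutCoreWith 𝓘₀` = (LSᴿ)_κN WITHOUT its level clause and quantified over INJECTIVE recuts only
  ((R1) `‖A‖ ≤ κL₀t` + `projectedFree`, (R7) `GoodAtScale η₃₀ (3/2) z₁ c₁`), and ★★★ `affineRecutG_of_core : RecutCoreWith 𝓘₀ᴿʷᴳ → AffineRecut 𝓘₀ᴿʷᴳ 𝓘₁ʷ 𝓑₀ τ₀ τ₁ κN♯ κL₀ T₀`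
  — the level clause of (RF) is DISCHARGED (no numerics left in (R6)); `recutCore_of_LS` (the old LS half implies the core on any sub-family).
No sorry, no new axioms, no cite tokens, no instances / notation.  `--supports stmt-AtomisticToContinuum-27623`.
-/

noncomputable section

namespace Summit.AtomisticToContinuum.Crystallization.Theorems.FrustratedLawDichotomyStrainedPatchRecutLevelGap

open scoped BigOperators Classical
open Summit.AtomisticToContinuum.Crystallization.Theorems.FrustratedLawDichotomyPeriodicBlockFlags (goodAtScale_mono)
open Summit.AtomisticToContinuum.Crystallization.Theorems.FrustratedLawDichotomyRangeCut (Sep)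
open Summit.AtomisticToContinuum.Crystallization.Theorems.FrustratedLawDichotomyMotifLemmas
open Summit.AtomisticToContinuum.Crystallization.Theorems.FrustratedLawDichotomyAveragingCut
open Summit.AtomisticToContinuum.Crystallization.Theorems.FrustratedLawDichotomyAveragingRuleCap
open Summit.AtomisticToContinuum.Crystallization.Theorems.FrustratedLawDichotomyAveragingRuleTightFree
open Summit.AtomisticToContinuum.Crystallization.Theorems.FrustratedLawDichotomyExemptDoor (SitePred)
open Summit.AtomisticToContinuum.Crystallization.Theorems.FrustratedLawDichotomyExemptAbsorption
open Summit.AtomisticToContinuum.Crystallization.Theorems.FrustratedLawDichotomyExemptAbsorptionRecord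
open Summit.AtomisticToContinuum.Crystallization.Theorems.FrustratedLawDichotomyCollarCensus
open Summit.AtomisticToContinuum.Crystallization.Theorems.FrustratedLawDichotomyCollarCensusKappa
open Summit.AtomisticToContinuum.Crystallization.Theorems.FrustratedLawDichotomyStrainedPatchHomSplit
open Summit.AtomisticToContinuum.Crystallization.Theorems.FrustratedLawDichotomyStrainedPatchCleanCollar
open Summit.AtomisticToContinuum.Crystallization.Theorems.FrustratedLawDichotomyStrainedPatchHomTube
open Summit.AtomisticToContinuum.Crystallization.Theorems.FrustratedLawDichotomyStrainedPatchHomIsometry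
open Summit.AtomisticToContinuum.Crystallization.Theorems.FrustratedLawDichotomyStrainedPatchHomTubeIso
open Summit.AtomisticToContinuum.Crystallization.Theorems.FrustratedLawDichotomyStrainedPatchPhaseCut
open Summit.AtomisticToContinuum.Crystallization.Theorems.FrustratedLawDichotomyStrainedPatchCoreTube
open Summit.AtomisticToContinuum.Crystallization.Theorems.FrustratedLawDichotomyStrainedPatchCoreTubeRecord
open Summit.AtomisticToContinuum.Crystallization.Theorems.FrustratedLawDichotomyStrainedPatchCoreTubeMilli
open Summit.AtomisticToContinuum.Crystallization.Theorems.FrustratedLawDichotomyStrainedPatchStrainBands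
open Summit.AtomisticToContinuum.Crystallization.Theorems.FrustratedLawDichotomyStrainedPatchChartFamilies
open Summit.AtomisticToContinuum.Crystallization.Theorems.FrustratedLawDichotomyStrainedPatchChartFamiliesBent
open Summit.AtomisticToContinuum.Crystallization.Theorems.FrustratedLawDichotomyStrainedPatchChartFamiliesPinned
open Summit.AtomisticToContinuum.Crystallization.Theorems.FrustratedLawDichotomyStrainedPatchEnvelopeLaw
open Summit.AtomisticToContinuum.Crystallization.Theorems.FrustratedLawDichotomyStrainedPatchEnvelopeTaylor
open Literature.Barriers.AtomisticToContinuum.FlatleyTheil2015 (fccVec)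
open Summit.AtomisticToContinuum.Crystallization.Theorems.FrustratedLawDichotomyStrainedPatchRecutPairs
open Summit.AtomisticToContinuum.Crystallization.Theorems.FrustratedLawDichotomyStrainedPatchRecutKinematics
open Literature.Barriers.AtomisticToContinuum.FlatleyTheil2015 (fccPoint)
open Summit.AtomisticToContinuum.Crystallization.Theorems.FrustratedLawDichotomyStrainedPatchHomRelief (latPt_fccVec_eq)
open Summit.AtomisticToContinuum.Crystallization.Theorems.FrustratedLawDichotomyStrainedPatchHomLatticeBox (norm_apply_ge_of_near_one latPt_zero
  mem_box_of_norm_fccPoint_lt)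
open Summit.AtomisticToContinuum.Crystallization.Theorems.FrustratedLawDichotomyStrainedPatchHomLatticeBoxHcp (latPt_eq_apply_one shifted_eq_apply)
open Summit.AtomisticToContinuum.Crystallization.Theorems.FrustratedLawDichotomyStrainedPatchHomLatticeBoxWindow (mem_box_of_norm_hexPt_lt'
  mem_box_of_norm_hexPt_add_shift_lt')
open Summit.AtomisticToContinuum.Crystallization.Theorems.FrustratedLawDichotomyStrainedPatchWindowFamilies
open Summit.AtomisticToContinuum.Crystallization.Theorems.FrustratedLawDichotomyStrainedPatchRecutBuild
open Summit.AtomisticToContinuum.Crystallization.Theorems.FrustratedLawDichotomyStrainedPatchRecutRecord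
open Summit.AtomisticToContinuum.Crystallization.Theorems.FrustratedLawDichotomyStrainedPatchRecutChart
open Literature.Geometry.DiscreteGeometry (nearestDist nearestDist_le_dist le_nearestDist exists_nearestDist_eq_dist nearestDist_nonneg
  fccKissingPattern hcpKissingPattern card_fccKissingPattern card_hcpKissingPattern norm_eq_one_of_mem_fccKissingPattern norm_eq_one_of_mem_hcpKissingPattern)
open Summit.AtomisticToContinuum.Crystallization.Theorems.FrustratedLawDichotomyStrainedPatchRecutLevel

/-! ## §1. ★ The shell gap transports -/

/-- ★ **THE SHELL GAP TRANSPORTS** — under the local `(1+A)`-correspondence at radius `3` (`‖A‖ ≤ α ≤ 1/20`, `nn_i(y) ≤ 3/2`, another site exists), a shell gap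
`g₀ ≤ 1/10` at `y i` gives the shell gap `g₁ ≥ 0` at `y' i'` as soon as `g₁(1+α) ≤ g₀(1−α) − (13/5)α` (outer shell: `(1−α)(13/10 + g₀)·nn ≥ (13/10 + g₁)(1+α)·nn
≥ (13/10 + g₁)·nn'`; inner shell a fortiori; sites beyond `3` are outer since `(7/5)(21/20)(3/2) ≤ 3`). [folklore] -/
theorem shellGap_recut {N N' : ℕ} {y : Fin N → E3} {i : Fin N} {y' : Fin N' → E3} {i' : Fin N'} (hy : Function.Injective y)
    (hy' : Function.Injective y') (A : E3 →L[ℝ] E3) {α g₀ g₁ : ℝ} (hA : ‖A‖ ≤ α) (hα : α ≤ 1 / 20)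
    (H1 : ∀ k', dist (y' k') (y' i') ≤ 3 → ∃ k, y' k' - y' i' = ((1 : E3 →L[ℝ] E3) + A) (y k - y i))
    (H2 : ∀ k, dist (y k) (y i) ≤ 3 → ∃ k', y' k' - y' i' = ((1 : E3 →L[ℝ] E3) + A) (y k - y i))
    (hex : ∃ k, k ≠ i) (hd : nearestDist y i ≤ 3 / 2) (hg₀ : g₀ ≤ 1 / 10) (hg₁0 : 0 ≤ g₁) (hg₁ : g₁ * (1 + α) ≤ g₀ * (1 - α) - 13 / 5 * α)
    (HG : ShellGap g₀ y i) : ShellGap g₁ y' i' := by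
  have hα0 : 0 ≤ α := (norm_nonneg A).trans hA
  have hnn := nearestDist_nonneg y i
  have hd3 : nearestDist y i ≤ 3 := by linarith
  have hup := nearestDist_recut_le hy A hA (by linarith) H2 hex hd3
  have hlo := le_nearestDist_recut hy hy' A hA (by linarith) H1 H2 hex hd3
  have hg₁le : g₁ ≤ g₀ := by nlinarith
  have hcin : (1 + α) * (13 / 10 - g₀) ≤ (13 / 10 - g₁) * (1 - α) := by nlinarith [mul_nonneg hg₁0 hα0, mul_nonneg (hg₁0.trans hg₁le) hα0]
  have hcout : (13 / 10 + g₁) * (1 + α) ≤ (1 - α) * (13 / 10 + g₀) := by nlinarith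
  intro k' hk'
  by_cases h3 : dist (y' k') (y' i') ≤ 3
  · obtain ⟨k, hk⟩ := H1 k' h3
    have hki : k ≠ i := by
      intro e; rw [e, sub_self, map_zero, sub_eq_zero] at hk
      exact hk' (hy' hk)
    have hdk : dist (y' k') (y' i') = ‖((1 : E3 →L[ℝ] E3) + A) (y k - y i)‖ := by rw [dist_eq_norm, hk]
    rcases HG k hki with hin | hout
    · left
      calc dist (y' k') (y' i') = ‖((1 : E3 →L[ℝ] E3) + A) (y k - y i)‖ := hdk
        _ ≤ (1 + α) * ‖y k - y i‖ := norm_one_add_apply_le A hA _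
        _ = (1 + α) * dist (y k) (y i) := by rw [dist_eq_norm]
        _ ≤ (1 + α) * ((13 / 10 - g₀) * nearestDist y i) := mul_le_mul_of_nonneg_left hin (by linarith)
        _ = (1 + α) * (13 / 10 - g₀) * nearestDist y i := by ring
        _ ≤ (13 / 10 - g₁) * (1 - α) * nearestDist y i := mul_le_mul_of_nonneg_right hcin hnn
        _ = (13 / 10 - g₁) * ((1 - α) * nearestDist y i) := by ring
        _ ≤ (13 / 10 - g₁) * nearestDist y' i' := mul_le_mul_of_nonneg_left hlo (by linarith)
    · right
      calc (13 / 10 + g₁) * nearestDist y' i' ≤ (13 / 10 + g₁) * ((1 + α) * nearestDist y i) := mul_le_mul_of_nonneg_left hup (by linarith)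
        _ = (13 / 10 + g₁) * (1 + α) * nearestDist y i := by ring
        _ ≤ (1 - α) * (13 / 10 + g₀) * nearestDist y i := mul_le_mul_of_nonneg_right hcout hnn
        _ = (1 - α) * ((13 / 10 + g₀) * nearestDist y i) := by ring
        _ ≤ (1 - α) * dist (y k) (y i) := mul_le_mul_of_nonneg_left hout (by linarith)
        _ = (1 - α) * ‖y k - y i‖ := by rw [dist_eq_norm]
        _ ≤ ‖((1 : E3 →L[ℝ] E3) + A) (y k - y i)‖ := antilipschitz_one_add A hA _
        _ = dist (y' k') (y' i') := hdk.symm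
  · right
    push Not at h3
    calc (13 / 10 + g₁) * nearestDist y' i' ≤ 7 / 5 * ((1 + α) * nearestDist y i) :=
          mul_le_mul (by linarith) hup (nearestDist_nonneg _ _) (by norm_num)
      _ ≤ 3 := by nlinarith
      _ ≤ dist (y' k') (y' i') := h3.le

/-! ## §2. ★★ (R6)♯ from chart-side columns only -/

/-- ★★ **(R6)♯ WITH CHART-SIDE COLUMNS ONLY** — for a centre-keeping recut `RecutOf A z₀ c₀ z₁ c₁ e₀ e₁` (`‖A‖ ≤ κL₀·max t 0`, `0 ≤ t ≤ 1/60`, `z₀`, `z₁` injective)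
of a chart with `ShellGap (1/20) z₀ c₀`, `nearestDist z₀ c₀ ≤ 7/5` and an `η₀₀ = 1/16`-good centre: `LevelNear κN♯ t z₀ c₀ z₁ c₁`.  (The recut-side gap `3/100 ≥ 4κL₀t`
comes from §1: `(3/100)(1+α) ≤ (1/20)(1−α) − (13/5)α` for `α ≤ 1/150`; the cap column `(1+α)·(7/5) ≤ (3/2)(1−α)`.) [folklore] -/
theorem levelNear_of_recutOf' {A : E3 →L[ℝ] E3} {M₀ : ℕ} {z₀ : Fin M₀ → E3} {c₀ : Fin M₀} {M₁ : ℕ} {z₁ : Fin M₁ → E3} {c₁ : Fin M₁} {M : ℕ}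
    {e₀ : Fin M → Fin M₀} {e₁ : Fin M → Fin M₁} (h : RecutOf A z₀ c₀ z₁ c₁ e₀ e₁) {t : ℝ} (hA : ‖A‖ ≤ kL0 * max t 0) (ht : 0 ≤ t) (ht60 : t ≤ 1 / 60)
    (hinj₀ : Function.Injective z₀) (hinj₁ : Function.Injective z₁) (HG₀ : ShellGap (1 / 20) z₀ c₀) (hnn : nearestDist z₀ c₀ ≤ 7 / 5)
    (h16 : GoodAtScale (1 / 16) (3 / 2) z₀ c₀) : LevelNear kN2 t z₀ c₀ z₁ c₁ := by
  have hmax : max t 0 = t := max_eq_left ht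
  have hA' : ‖A‖ ≤ kL0 * t := by rw [hmax] at hA; exact hA
  have hkl : kL0 * t = 2 / 5 * t := by rw [kL0]
  have hα150 : kL0 * t ≤ 1 / 150 := by rw [hkl]; linarith
  have hα0 : 0 ≤ kL0 * t := by rw [hkl]; positivity
  have hnn0 := nearestDist_nonneg z₀ c₀
  obtain ⟨H1, H2⟩ := recutOf_local h (hA'.trans hα150)
  have hex := exists_ne_of_goodAtScale h16
  have HG₁ : ShellGap (3 / 100) z₁ c₁ :=
    shellGap_recut hinj₀ hinj₁ A hA' (by linarith) H1 H2 hex (by linarith) (by norm_num) (by norm_num) (by linarith) HG₀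
  exact levelNear_of_recutOf h hA ht ht60 hinj₀ hinj₁ (HG₀.mono (by norm_num)) HG₁ (by linarith) (by norm_num) (by norm_num)
    (by nlinarith [mul_le_mul_of_nonneg_left hnn hα0]) h16

/-! ## §3. The designate chart family `𝓘₀ᴿʷᴳ` and the least-squares CORE -/

/-- ★ **`ChartFamilyRWG` = `𝓘₀ᴿʷᴳ`** [DESIGNATE chart family of the next record] — the recut-pair chart family `𝓘₀ᴿʷ` with the two GEOMETRIC columns that discharge
the level clause: the shell gap `ShellGap (1/20) z₀ c₀` (no site in the annulus `(1.25·nn, 1.35·nn)` about the centre) and `nearestDist z₀ c₀ ≤ 7/5`. -/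
def ChartFamilyRWG : (M₀ : ℕ) → (Fin M₀ → E3) → Fin M₀ → Prop :=
  fun M₀ z₀ c₀ => ChartFamilyRW M₀ z₀ c₀ ∧ ShellGap (1 / 20) z₀ c₀ ∧ nearestDist z₀ c₀ ≤ 7 / 5

/-- `𝓘₀ᴿʷᴳ ≤ 𝓘₀ᴿʷ`. [formal bookkeeping] -/
theorem chartFamilyRWG_le : FamilyLE ChartFamilyRWG ChartFamilyRW := fun _ _ _ h => h.1

/-- ★ **(LS-CORE)_𝓘₀ `RecutCoreWith 𝓘₀`** [THE LEAST-SQUARES CORE · NUMERICAL / INSTRUMENTABLE (census KAPPA-L, GOOD27)] — for every admissible clean mono-phase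
cluster charted by `z₀ ∈ 𝓘₀` (coarse `1/4`, fine `0 ≤ t ≤ T₀(z₀)`, labels `e₀`) there is a matrix `A` with `‖A‖ ≤ κL₀·t` such that every INJECTIVE centre-keeping
recut `(z₁, c₁, e₁)` of the chart by `A` has an `η₃₀`-good centre and carries the projected affine-free deviation (the normal equations of `A = A_LS`).
= `RecutLSWith κN` of `…RecutChart` WITHOUT its level clause (now a theorem, §2) and restricted to injective recuts (THE recut of `…RecutBuild` is injective). -/
def RecutCoreWith (𝓘₀ : (M₀ : ℕ) → (Fin M₀ → E3) → Fin M₀ → Prop) : Prop :=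
  ∀ (M : ℕ) (z : Fin M → E3) (c : Fin M) (M₀ : ℕ) (z₀ : Fin M₀ → E3) (c₀ : Fin M₀) (e₀ : Fin M → Fin M₀) (t : ℝ),
    Admissible M z c → CleanBall (63 / 10) z c → MonoPhaseBall (63 / 10) z c → 0 ≤ t → t ≤ T0 M₀ z₀ c₀ → ChartBy 𝓘₀ tau0 t z c z₀ c₀ e₀ →
      ∃ A : E3 →L[ℝ] E3, ‖A‖ ≤ kL0 * max t 0 ∧
        ∀ (M₁ : ℕ) (z₁ : Fin M₁ → E3) (c₁ : Fin M₁) (e₁ : Fin M → Fin M₁), RecutOf A z₀ c₀ z₁ c₁ e₀ e₁ → z₁ c₁ = z₀ c₀ → Function.Injective z₁ →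
          GoodAtScale eta30 (3 / 2) z₁ c₁ ∧ projectedFree M z c M₁ z₁ c₁ e₁ t

/-- The core is ANTITONE in the chart family. [formal bookkeeping] -/
theorem RecutCoreWith.anti {𝓘 𝓘' : (M₀ : ℕ) → (Fin M₀ → E3) → Fin M₀ → Prop} (hle : FamilyLE 𝓘 𝓘') (h : RecutCoreWith 𝓘') : RecutCoreWith 𝓘 :=
  fun M z c M₀ z₀ c₀ e₀ t hadm hclean hmono ht ht' hch => h M z c M₀ z₀ c₀ e₀ t hadm hclean hmono ht ht' (hch.mono_family hle)

/-- The old least-squares half (any level constant) gives the core on `𝓘₀ᴿʷ`, hence on every sub-family. [formal bookkeeping] -/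
theorem recutCore_of_LS {κN : ℝ} (h : RecutLSWith κN) : RecutCoreWith ChartFamilyRW := by
  intro M z c M₀ z₀ c₀ e₀ t hadm hclean hmono ht ht' hch
  obtain ⟨A, hA, hLS⟩ := h M z c M₀ z₀ c₀ e₀ t hadm hclean hmono ht ht' hch
  exact ⟨A, hA, fun M₁ z₁ c₁ e₁ hRO hy _ => ⟨(hLS M₁ z₁ c₁ e₁ hRO hy).2.1, (hLS M₁ z₁ c₁ e₁ hRO hy).2.2⟩⟩

/-- **(LS-COREᴳ) `RecutCoreG := RecutCoreWith 𝓘₀ᴿʷᴳ`** — the designate least-squares binder of the next record. -/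
def RecutCoreG : Prop := RecutCoreWith ChartFamilyRWG

/-- ★★★ **(RFᴿᴳ♯) FROM THE LEAST-SQUARES CORE** — `RecutCoreG → AffineRecut 𝓘₀ᴿʷᴳ 𝓘₁ʷ 𝓑₀ τ₀ τ₁ κN♯ κL₀ T₀`: existence, `RecutNear`, injectivity, separation,
bentness, membership and the coarse chart are the terms of `…RecutBuild` / `…RecutChart`; the LEVEL clause `LevelNear κN♯` is `levelNear_of_recutOf'` (§2) on the two
geometric columns of `𝓘₀ᴿʷᴳ`; what is imported is exactly (R1) + (R7). [folklore] -/
theorem affineRecutG_of_core (h : RecutCoreG) : AffineRecut ChartFamilyRWG CompFamilyW bends0 tau0 tau1 kN2 kL0 T0 := by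
  intro M z c M₀ z₀ c₀ e₀ t hadm hclean hmono ht ht' hch
  obtain ⟨A, hA, hcore⟩ := h M z c M₀ z₀ c₀ e₀ t hadm hclean hmono ht ht' hch
  have hI : ChartFamilyRWG M₀ z₀ c₀ := hch.1
  have hch' : ChartBy ChartFamilyRW tau0 t z c z₀ c₀ e₀ := hch.mono_family chartFamilyRWG_le
  obtain ⟨M₁, z₁, c₁, e₁, hRO, hy, hRN, hinj₁, -, -, hchart⟩ := exists_chart_recut_of_chartFamilyRW hch' ht ht' A hA (z₀ c₀)
  obtain ⟨hgood, hpf⟩ := hcore M₁ z₁ c₁ e₁ hRO hy hinj₁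
  have hinj₀ : Function.Injective z₀ := hI.1.1.1.1
  have h16 : GoodAtScale (1 / 16) (3 / 2) z₀ c₀ := hI.1.1.2.2
  have ht60 : t ≤ 1 / 60 := ht'.trans (T0_le_of_goodAtScale h16)
  exact ⟨M₁, z₁, c₁, e₁, levelNear_of_recutOf' hRO hA ht ht60 hinj₀ hinj₁ hI.2.1 hI.2.2 h16, hRN, hchart hgood, hpf⟩

/-- (RFᴿᴳ♯) from the OLD least-squares half at any level constant (via the core): the level constant of `RecutLSWith` is now immaterial. [formal bookkeeping] -/
theorem affineRecutG_of_LS {κN : ℝ} (h : RecutLSWith κN) : AffineRecut ChartFamilyRWG CompFamilyW bends0 tau0 tau1 kN2 kL0 T0 :=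
  affineRecutG_of_core ((recutCore_of_LS h).anti chartFamilyRWG_le)

end Summit.AtomisticToContinuum.Crystallization.Theorems.FrustratedLawDichotomyStrainedPatchRecutLevelGap
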